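import Mathlib
import HarnessLib
import Literature.Analysis.FluidPDE.SuitableWeak
import Literature.Analysis.FluidPDE.SelfSimilar
import Literature.Analysis.FluidPDE.LocalTypeI
import Literature.Analysis.FluidPDE.SpaceTimeRescaling
import Literature.Analysis.FluidPDE.LocalTypeIScaling
import Literature.Analysis.FluidPDE.LocalTypeICongr
import Literature.Analysis.FluidPDE.LocalTypeIReverseZoom
import Literature.Analysis.FluidPDE.SlabTypeICompactness
import Literature.Analysis.FluidPDE.TypeIRateOseenMildRepresentative
import Summits.NavierStokesRegularity.NavierStokesRegularity.Theorems.RellichScarApexLocalisationSpherePersistence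
import Summits.NavierStokesRegularity.NavierStokesRegularity.Theorems.RellichScarApexLocalisationMovingCentrePersistence
import Summits.NavierStokesRegularity.NavierStokesRegularity.Theorems.RellichScarApexLocalisationParentChild
import Summits.NavierStokesRegularity.NavierStokesRegularity.Theorems.RellichScarApexLocalisationClassBlowupPersistence
import Summits.NavierStokesRegularity.NavierStokesRegularity.Theorems.RellichScarApexLocalisationSmallRateRegularity
import Summits.NavierStokesRegularity.NavierStokesRegularity.Theorems.RellichScarApexLocalisationConfinementImpliesApex
import Summits.NavierStokesRegularity.NavierStokesRegularity.Theorems.RellichScarApexLocalisationCleanTrunkCompactness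
import Summits.NavierStokesRegularity.NavierStokesRegularity.Theorems.RellichScarApexLocalisationFissionCertificate
import Summits.NavierStokesRegularity.NavierStokesRegularity.Theorems.RellichScarApexLocalisationFissionReductionCore
import Summits.NavierStokesRegularity.NavierStokesRegularity.Theorems.RellichScarApexLocalisationParabolicActivity
import Summits.NavierStokesRegularity.NavierStokesRegularity.Theses.RellichScar

/-!
# Skeleton v2.2 — line `activity-genealogy-fission` for crux `RellichScar.ApexLocalisation`
(stmt-NavierStokesRegularity-11719; lead prover-line-stmt-NavierStokesRegularity-11719-c2-0)

RESHAPE of seat 1's skeleton (`Cruxes/ApexLocalisation/Lines/activity_genealogy_fission.lean`)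
into the CONTINUOUS class used by every landed `RellichScarApexLocalisation*` file (lead c1):
class data of a profile `(u,p,G)` with constants `(C, I)` are
`IsSuitableWeakSolutionOn 𝕊 1 0 u p`, `HasWeakSpatialGradientOn 𝕊 u G`,
`typeIBound (Iio 0 ×ˢ univ) u p G ≤ I` (`I < ⊤`), `HasTypeITimeDecay C u`,
`ContinuousOn (uncurry u) (Iio 0 ×ˢ univ)`, `𝕊 = slab (EuclideanSpace ℝ (Fin 3)) (Iio 0) isOpen_Iio`.
Apex = "Type-I-quiet outside a paraboloid": `u` is `η`-QUIET outside the paraboloid of aperture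
`R` when `√(−t) ‖u(t,x)‖ ≤ η` for all `t < 0` and `R √(−t) ≤ ‖x‖`.

* `stub_classBlowupPersistence` (E, KNOWN — the engine `slab_typeI_compactness` run on
  Navier–Stokes images of a SEQUENCE of class profiles; `stub_spherePersistence` is the case of one
  profile): images `λ_k u_k(λ_k² t, x_k + λ_k x)` of continuous class profiles `(u_k,p_k,G_k)` with
  data `(C, I)` which blow up at their own origin column at times `t_k ↑ 0` subconverge in
  `L³(Q(0,R))` (∀R) to a continuous class profile with data `(C, 4I)`, SINGULAR AT THE ORIGIN.
* `stub_smallRateRegularity` (S1a, KNOWN — ε-regularity in rate form, by the engine + persistence):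
  for `I < ⊤` there is `η > 0` such that a suitable weak slab solution with `𝐈 ≤ I` and the SMALL
  rate `‖u‖ ≤ η/√(−t)` a.e. on `Q(0,1)` is not backward-singular at the origin (a violating sequence
  `η_k → 0` has a limit vanishing a.e. on `Q(0,1)` yet singular at the origin).
* `stub_confinementImpliesApex` (S1b, KNOWN modulo E and S1a, which it takes as inputs — the card's
  dictionary (D1) "confinement ⇔ apex", uniform in the class): for `(C, I)` there is `η > 0` and for
  every aperture `R > 0` a constant `C'` such that every continuous class profile `(C, I)` that is
  `η`-quiet outside the paraboloid of aperture `R` has the apex bound `HasTypeIDecay C' u`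
  (violators `‖x_k‖ ‖u_k(t_k,x_k)‖ → ∞` lie outside the paraboloid, the rate forces
  `t_k/‖x_k‖² → 0`; E at scales `‖x_k‖`, centres `x_k` gives an origin-singular limit which is
  `η`-quiet on a small cylinder `Q(0,r₀)` — absurd by S1a after the zoom `1/r₀`, at `𝐈 ≤ 4I`).
* `stub_cleanTrunkCompactness` (S2, KNOWN — engine + persistence at the fixed origin + a.e. → pointwise
  by continuity): origin-singular continuous class profiles `(C, I)` that are `η`-quiet outside the
  paraboloid on the windows `ε ≤ ‖x‖ + √(−t) ≤ ε⁻¹`, `ε → 0`, produce an origin-singular continuous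
  class profile `(C, 4I)` that is `η`-quiet outside the paraboloid EVERYWHERE.
* `stub_noPerpetualFission` (T, THE BET, window form; crux-equivalent given E, S1a, S1b, S2 — the
  converse `noPerpetualFission_of_apexLocalisation` is proved separately): if a rate-Type-I singular
  slab profile exists, then for some continuous class `(C₁, I₁)`: for every activity threshold `η > 0`
  there is an aperture `R` such that for every `ε > 0` SOME origin-singular profile of the class is
  `η`-quiet outside the paraboloid of aperture `R` on the `ε`-window — arbitrarily long fission-free
  trunks exist somewhere in the Type-I world.

Composition `ApexLocalisation_of`: T ⇒ `(C₁, I₁)`; S1b at `(C₁, 4I₁)` ⇒ `η`; T ⇒ `R`; S1b ⇒ `C'`;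
S2 ⇒ a confined origin-singular continuous profile with `𝐈 ≤ 4I₁`; S1b ⇒ `HasTypeIDecay C'` ⇒ crux.
Everything is INLINED (no new definitions).

STATUS v2.1 (2026-08-16T15:10Z): stubs E, S1a, S1b, S2 LANDED (p106827, p107264, p108091, p108561; imported above,
same names), the certificate crux ⇒ T `noPerpetualFission_of_apexLocalisation` (p106403) and the core composition
`apexLocalisation_of_fissionStubs` (p110416) LANDED; by-products `slab_typeI_compactness_sharp` (p109562, Literature) and
`stub_parabolicActivity` (p110131) LANDED: the ONLY `sorry` left is the bet `stub_noPerpetualFission`, which is therefore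
EXACTLY as strong as the crux (`apexLocalisation_iff_noPerpetualFission`).
-/

-- the summit and its single sub-problem share the name (CONVENTIONS §1), as in every Theorems file
set_option linter.dupNamespace false

namespace Summit.NavierStokesRegularity.NavierStokesRegularity.Theorems.RellichScarApexLocalisation

open MeasureTheory Set Function Metric Filter Topology TopologicalSpace
open scoped ENNReal NNReal
open Literature.Analysis Literature.Analysis.FluidPDE

/-! ### Stubs E, S1a, S1b, S2 — LANDED (imported above)

* `stub_classBlowupPersistence` — `…Theorems.RellichScarApexLocalisationClassBlowupPersistence` (p106827)
* `stub_smallRateRegularity`    — `…Theorems.RellichScarApexLocalisationSmallRateRegularity` (p107264)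
* `stub_confinementImpliesApex` — `…Theorems.RellichScarApexLocalisationConfinementImpliesApex` (p108091)
* `stub_cleanTrunkCompactness`  — `…Theorems.RellichScarApexLocalisationCleanTrunkCompactness` (p108561)
* certificate crux ⇒ bet: `noPerpetualFission_of_apexLocalisation` — `…Theorems.RellichScarApexLocalisationFissionCertificate` (p106403)
-/

/-! ### Stub T — THE BET: no perpetual fission (window form) -/

/-- **T, NO PERPETUAL FISSION (window form; THE BET).** If a rate-Type-I singular slab profile with
constant `C` exists (the crux antecedent), then for some continuous class `(C₁, I₁)`, `I₁ < ⊤`: for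
every activity threshold `η > 0` there is an aperture `R > 0` such that for every `ε > 0` some profile
of the class, backward-singular at the origin, has rate usage `√(−t)‖u(t,x)‖ ≤ η` at every point
outside the paraboloid `‖x‖ ≤ R√(−t)` of the window `ε ≤ ‖x‖ + √(−t) ≤ ε⁻¹` — a fission-free trunk
of log-length `2 log ε⁻¹` at a singular point. The open content of the crux: implied back by it
(`noPerpetualFission_of_apexLocalisation`: an apex profile is confined with `R = C'/η`), i.e.
crux-equivalent given E, S1a, S1b, S2; its enemy is perpetual fission at every scale of every flow
(scaling-recurrent dust / self-sustained satellite gas). -/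
theorem stub_noPerpetualFission :
    ∀ C : ℝ, (∃ (u : ℝ → (EuclideanSpace ℝ (Fin 3)) → (EuclideanSpace ℝ (Fin 3))) (p : ℝ → (EuclideanSpace ℝ (Fin 3)) → ℝ) (G : ℝ → (EuclideanSpace ℝ (Fin 3)) → (EuclideanSpace ℝ (Fin 3)) →L[ℝ] (EuclideanSpace ℝ (Fin 3))),
        IsSuitableWeakSolutionOn (slab (EuclideanSpace ℝ (Fin 3)) (Iio 0) isOpen_Iio) 1 0 u p ∧
        HasWeakSpatialGradientOn (slab (EuclideanSpace ℝ (Fin 3)) (Iio 0) isOpen_Iio) u G ∧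
        typeIBound (Set.Iio (0 : ℝ) ×ˢ Set.univ) u p G < ⊤ ∧ HasTypeITimeDecay C u ∧
        IsBackwardSingularPoint u 0) →
      ∃ (C₁ : ℝ) (I₁ : ℝ≥0∞), I₁ < ⊤ ∧ ∀ η : ℝ, 0 < η → ∃ R : ℝ, 0 < R ∧ ∀ ε : ℝ, 0 < ε →
        ∃ (u : ℝ → (EuclideanSpace ℝ (Fin 3)) → (EuclideanSpace ℝ (Fin 3))) (p : ℝ → (EuclideanSpace ℝ (Fin 3)) → ℝ) (G : ℝ → (EuclideanSpace ℝ (Fin 3)) → (EuclideanSpace ℝ (Fin 3)) →L[ℝ] (EuclideanSpace ℝ (Fin 3))),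
          IsSuitableWeakSolutionOn (slab (EuclideanSpace ℝ (Fin 3)) (Iio 0) isOpen_Iio) 1 0 u p ∧
          HasWeakSpatialGradientOn (slab (EuclideanSpace ℝ (Fin 3)) (Iio 0) isOpen_Iio) u G ∧
          typeIBound (Iio (0 : ℝ) ×ˢ univ) u p G ≤ I₁ ∧
          HasTypeITimeDecay C₁ u ∧
          ContinuousOn (uncurry u) (Iio (0 : ℝ) ×ˢ univ) ∧
          IsBackwardSingularPoint u 0 ∧
          ∀ t : ℝ, t < 0 → ∀ x : (EuclideanSpace ℝ (Fin 3)), ε ≤ ‖x‖ + Real.sqrt (-t) → ‖x‖ + Real.sqrt (-t) ≤ ε⁻¹ →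
            R * Real.sqrt (-t) ≤ ‖x‖ → Real.sqrt (-t) * ‖u t x‖ ≤ η := by
  sorry

/-! ### Composition -/

/-- **The bet implies the crux** (composition with the four landed known stubs, via the landed core
`apexLocalisation_of_fissionStubs`, p110416). Primed: the unprimed name is reserved for the landed file
`…Theorems.RellichScarApexLocalisationFissionReduction`. -/
theorem apexLocalisation_of_noPerpetualFission'
    (hT : ∀ C : ℝ, (∃ (u : ℝ → (EuclideanSpace ℝ (Fin 3)) → (EuclideanSpace ℝ (Fin 3))) (p : ℝ → (EuclideanSpace ℝ (Fin 3)) → ℝ) (G : ℝ → (EuclideanSpace ℝ (Fin 3)) → (EuclideanSpace ℝ (Fin 3)) →L[ℝ] (EuclideanSpace ℝ (Fin 3))), IsSuitableWeakSolutionOn (slab (EuclideanSpace ℝ (Fin 3)) (Iio 0) isOpen_Iio) 1 0 u p ∧ HasWeakSpatialGradientOn (slab (EuclideanSpace ℝ (Fin 3)) (Iio 0) isOpen_Iio) u G ∧ typeIBound (Set.Iio (0 : ℝ) ×ˢ Set.univ) u p G < ⊤ ∧ HasTypeITimeDecay C u ∧ IsBackwardSingularPoint u 0) → ∃ (C₁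 : ℝ) (I₁ : ℝ≥0∞), I₁ < ⊤ ∧ ∀ η : ℝ, 0 < η → ∃ R : ℝ, 0 < R ∧ ∀ ε : ℝ, 0 < ε → ∃ (u : ℝ → (EuclideanSpace ℝ (Fin 3)) → (EuclideanSpace ℝ (Fin 3))) (p : ℝ → (EuclideanSpace ℝ (Fin 3)) → ℝ) (G : ℝ → (EuclideanSpace ℝ (Fin 3)) → (EuclideanSpace ℝ (Fin 3)) →L[ℝ] (EuclideanSpace ℝ (Fin 3))), IsSuitableWeakSolutionOn (slab (EuclideanSpace ℝ (Fin 3)) (Iio 0) isOpen_Iio) 1 0 u p ∧ HasWeakSpatialGradientOn (slab (EuclideanSpace ℝ (Fin 3)) (Iio 0) isOpen_Iio) u G ∧ typeIBound (Iio (0 : ℝ) ×ˢ univ) u p G ≤ I₁ ∧ HasTypeITimeDecay C₁ u ∧ ContinuousOn (uncurry u) (Iio (0 : ℝ) ×ˢ univ) ∧ IsBackwardSingularPoint u 0 ∧ ∀ t : ℝ, t < 0 → ∀ x : (EuclideanSpace ℝ (Fin 3)), ε ≤ ‖x‖ + Real.sqrt (-t) → ‖x‖ + Real.sqrt (-t)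 ≤ ε⁻¹ → R * Real.sqrt (-t) ≤ ‖x‖ → Real.sqrt (-t) * ‖u t x‖ ≤ η) :
    Summit.NavierStokesRegularity.NavierStokesRegularity.Theses.RellichScar.ApexLocalisation :=
  apexLocalisation_of_fissionStubs
    (stub_confinementImpliesApex stub_classBlowupPersistence stub_smallRateRegularity)
    stub_cleanTrunkCompactness hT

/-- **Crux ⇔ bet**: the registered bet `stub_noPerpetualFission` is EXACTLY as strong as the crux
(⇒ is the landed certificate `noPerpetualFission_of_apexLocalisation`, p106403). Primed: the unprimed
name is reserved for the landed file `…Theorems.RellichScarApexLocalisationFissionReduction`. -/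
theorem apexLocalisation_iff_noPerpetualFission' :
    Summit.NavierStokesRegularity.NavierStokesRegularity.Theses.RellichScar.ApexLocalisation ↔
    (∀ C : ℝ, (∃ (u : ℝ → (EuclideanSpace ℝ (Fin 3)) → (EuclideanSpace ℝ (Fin 3))) (p : ℝ → (EuclideanSpace ℝ (Fin 3)) → ℝ) (G : ℝ → (EuclideanSpace ℝ (Fin 3)) → (EuclideanSpace ℝ (Fin 3)) →L[ℝ] (EuclideanSpace ℝ (Fin 3))), IsSuitableWeakSolutionOn (slab (EuclideanSpace ℝ (Fin 3)) (Iio 0) isOpen_Iio) 1 0 u p ∧ HasWeakSpatialGradientOn (slab (EuclideanSpace ℝ (Fin 3)) (Iio 0) isOpen_Iio) u G ∧ typeIBound (Set.Iio (0 : ℝ) ×ˢ Set.univ) u p G < ⊤ ∧ HasTypeITimeDecay C u ∧ IsBackwardSingularPoint u 0) → ∃ (C₁ : ℝ) (I₁ : ℝ≥0∞), I₁ < ⊤ ∧ ∀ η : ℝ, 0 < η → ∃ R : ℝ, 0 < R ∧ ∀ ε : ℝ, 0 < ε → ∃ (u : ℝ → (EuclideanSpace ℝ (Fin 3)) → (EuclideanSpace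 ℝ (Fin 3))) (p : ℝ → (EuclideanSpace ℝ (Fin 3)) → ℝ) (G : ℝ → (EuclideanSpace ℝ (Fin 3)) → (EuclideanSpace ℝ (Fin 3)) →L[ℝ] (EuclideanSpace ℝ (Fin 3))), IsSuitableWeakSolutionOn (slab (EuclideanSpace ℝ (Fin 3)) (Iio 0) isOpen_Iio) 1 0 u p ∧ HasWeakSpatialGradientOn (slab (EuclideanSpace ℝ (Fin 3)) (Iio 0) isOpen_Iio) u G ∧ typeIBound (Iio (0 : ℝ) ×ˢ univ) u p G ≤ I₁ ∧ HasTypeITimeDecay C₁ u ∧ ContinuousOn (uncurry u) (Iio (0 : ℝ) ×ˢ univ) ∧ IsBackwardSingularPoint u 0 ∧ ∀ t : ℝ, t < 0 → ∀ x : (EuclideanSpace ℝ (Fin 3)), ε ≤ ‖x‖ + Real.sqrt (-t) → ‖x‖ + Real.sqrt (-t) ≤ ε⁻¹ → R * Real.sqrt (-t) ≤ ‖x‖ → Real.sqrt (-t) * ‖u t x‖ ≤ η) :=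
  ⟨noPerpetualFission_of_apexLocalisation, apexLocalisation_of_noPerpetualFission'⟩

/-- COMPOSITION of the line `activity-genealogy-fission` (v2.1): the five stubs imply the crux
`RellichScar.ApexLocalisation` (by name). -/
theorem ApexLocalisation_of :
    Summit.NavierStokesRegularity.NavierStokesRegularity.Theses.RellichScar.ApexLocalisation :=
  apexLocalisation_of_noPerpetualFission' stub_noPerpetualFission

end Summit.NavierStokesRegularity.NavierStokesRegularity.Theorems.RellichScarApexLocalisation
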